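import Literature.Analysis.FluidPDE.Seregin2024AxisymTypeIIScenarioReduction
import Literature.Analysis.FluidPDE.Seregin2023.TypeIIScenarioExcludedConsequences
import HarnessLib

/-!
# Seregin 2024, Prop. 2.3 / Cor. 2.4 (axisymmetric Type II power-concentration scenario): the two
# named facts DISCHARGED

Proof-only file (no definition, no named fact, no `sorry`): the discharges
`seregin2024_axisym_typeII_scenario_excluded_Lq_holds` and
`seregin2024_axisym_typeII_scenario_excluded_vorticity_holds` of the two named facts of
`Seregin2024AxisymTypeIIScenario.lean` (G. Seregin, *A note on potential Type II blowups of
axisymmetric solutions to the Navier–Stokes equations*, arXiv:2402.13229 (2024)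
[`Seregin2024AxisymTypeII`], Prop. 2.3 and Cor. 2.4, §2 p. 7).

The route is the one of `Seregin2024AxisymTypeIIScenarioReduction.lean` (HARVEST-MAP ruling C24:
both facts follow from G. Seregin, arXiv:2606.29468 (2026) [`Seregin2026`], Thm 2.1, since the
scenario (1.2)–(1.3) is the case `s = l = 3`, `f(r) = r^{1-m}` of the scenario Thm 2.1 excludes),
with the named fact `Seregin2023.seregin2026_typeII_scenario_excluded` used there as a hypothesis
now replaced by the PROVED theorem
`Seregin2023.seregin2026_typeII_scenario_excluded_continuousWeight_holds`
(`Seregin2023/TypeIIScenarioExcluded.lean`: Thm 2.1 for continuous scenario weights — power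
weights are continuous) through its unconditional consequence
`Seregin2023.seregin2026_typeII_scenario_excluded_continuousWeight.tendsto_cubic_seregin2025`
(`Seregin2023/TypeIIScenarioExcludedConsequences.lean`):

* `Seregin2024ScenarioHypotheses.tendsto_morreyM` — under the standing hypotheses (of which only
  the class, (1.13) and (1.3) are used) `M^{3,3}_{2,m₀}(v, r) → 0` as `r → 0⁺`;
* the two `_holds` theorems (the extra integrability hypotheses (2.3), resp. the vorticity bound,
  of the facts are not needed).

## References

* G. Seregin, arXiv:2402.13229 (2024), Prop. 2.3, Cor. 2.4 (§2 p. 7). [`Seregin2024AxisymTypeII`]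
* G. Seregin, arXiv:2606.29468 (2026), Thm 2.1 (p. 5), proof pp. 6–7. [`Seregin2026`]
* G. Seregin, arXiv:2507.08733 (2025), Thm 1.1. [`Seregin2025TypeIIScenario`]
-/

noncomputable section

open _root_.MeasureTheory _root_.Set _root_.Filter _root_.Metric _root_.Function
  _root_.TopologicalSpace
open scoped _root_.ENNReal _root_.NNReal _root_.Topology

namespace Literature.Analysis.FluidPDE

namespace Seregin2024ScenarioHypotheses

variable {v : ℝ → EuclideanSpace ℝ (Fin 3) → EuclideanSpace ℝ (Fin 3)}
  {q : ℝ → EuclideanSpace ℝ (Fin 3) → ℝ}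
  {G : ℝ → EuclideanSpace ℝ (Fin 3) → EuclideanSpace ℝ (Fin 3) →L[ℝ] EuclideanSpace ℝ (Fin 3)}
  {H : ℝ → EuclideanSpace ℝ (Fin 3) →
    EuclideanSpace ℝ (Fin 3) →L[ℝ] EuclideanSpace ℝ (Fin 3) →L[ℝ] EuclideanSpace ℝ (Fin 3)}
  {W : ℝ → EuclideanSpace ℝ (Fin 3) → EuclideanSpace ℝ (Fin 3)} {m s₁ l₁ c : ℝ}

/-- **The Seregin-2024 scenario quantity tends to zero — unconditionally.** Under the standing
hypotheses `Seregin2024ScenarioHypotheses v q G H W m s₁ l₁ c` (only the class, (1.13) and (1.3)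
are used): `M^{3,3}_{2,m₀}(v,r) → 0` as `r → 0⁺`, `m₀ = 2m/(3-m)`. The proof of
`tendsto_morreyM_of_seregin2026` with the hypothesis `(h : seregin2026_typeII_scenario_excluded)`
replaced by the proved `…_continuousWeight.tendsto_cubic_seregin2025`.
[cite: Seregin2024AxisymTypeII, Prop. 2.3 (arXiv:2402.13229 §2 p. 7); Seregin2026, Thm 2.1 (p. 5); Seregin2025TypeIIScenario, Thm 1.1 (p. 2)] -/
theorem tendsto_morreyM (hyp : Seregin2024ScenarioHypotheses v q G H W m s₁ l₁ c) :
    Tendsto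
      (fun r : ℝ =>
        Seregin2023.morreyM (2 * (2 * m / (3 - m))) 3 3 (0 : ℝ × EuclideanSpace ℝ (Fin 3)) v r)
      (𝓝[>] 0) (𝓝 0) := by
  have hG := hyp.hasWeakSpatialGradientOn_ball
  have hlim :=
    Seregin2023.seregin2026_typeII_scenario_excluded_continuousWeight.tendsto_cubic_seregin2025
      hyp.isSuitableWeakSolutionInBall hG hyp.m_mem_Ioo hyp.hasWeightedEnergyBound
  refine hlim.congr' ?_
  filter_upwards [Ioo_mem_nhdsGT (zero_lt_one' ℝ)] with r hr
  have hsub : parabolicCylinder r (0 : ℝ × EuclideanSpace ℝ (Fin 3)) ⊆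
      (parabolicCylinderOpens 1 (0 : ℝ × EuclideanSpace ℝ (Fin 3)) :
        Set (ℝ × EuclideanSpace ℝ (Fin 3))) := by
    rw [coe_parabolicCylinderOpens]
    have h2 : r ^ 2 ≤ 1 ^ 2 := pow_le_pow_left₀ hr.1.le hr.2.le 2
    exact prod_mono (Ioo_subset_Ioo (by linarith) le_rfl) (ball_subset_ball hr.2.le)
  have hmeas : AEStronglyMeasurable (uncurry v)
      (volume.restrict (parabolicCylinder r (0 : ℝ × EuclideanSpace ℝ (Fin 3)))) :=
    hG.locallyIntegrableOn.aestronglyMeasurable.mono_set hsub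
  exact (Seregin2023.morreyM_two_mul_three_three_eq (2 * m / (3 - m)) hmeas).symm

end Seregin2024ScenarioHypotheses

/-! ### The two discharges -/

/-- **Discharge of `seregin2024_axisym_typeII_scenario_excluded_Lq`** ([Seregin2024AxisymTypeII]
Prop. 2.3, §2 p. 7: under (1.2)–(1.3), the class hypotheses and (2.3), the Type II scenario at the
origin is excluded, i.e. `M^{3,3}_{2,m₀}(v, r) → 0`): by `Seregin2024ScenarioHypotheses.tendsto_morreyM`
(the integrability hypothesis (2.3) `ess sup_t ∫_𝒞 |v|^q < ∞` is not needed), i.e. by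
[Seregin2026] Thm 2.1, proved in `Seregin2023/TypeIIScenarioExcluded.lean`.
[cite: Seregin2024AxisymTypeII, Prop. 2.3 (arXiv:2402.13229 §2 p. 7); Seregin2026, Thm 2.1 (p. 5), proof pp. 6–7] -/
theorem seregin2024_axisym_typeII_scenario_excluded_Lq_holds :
    seregin2024_axisym_typeII_scenario_excluded_Lq :=
  fun _v _q _G _H _W _m _s₁ _l₁ _c hyp _ => hyp.tendsto_morreyM

/-- **Discharge of `seregin2024_axisym_typeII_scenario_excluded_vorticity`**
([Seregin2024AxisymTypeII] Cor. 2.4, §2 p. 7: the same conclusion under the vorticity bound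
`ess sup_t ∫_𝒞 |∇ × v|^{q₁} < ∞` in place of (2.3)): by
`Seregin2024ScenarioHypotheses.tendsto_morreyM` (the vorticity bound is not needed).
[cite: Seregin2024AxisymTypeII, Cor. 2.4 (arXiv:2402.13229 §2 p. 7); Seregin2026, Thm 2.1 (p. 5), proof pp. 6–7] -/
theorem seregin2024_axisym_typeII_scenario_excluded_vorticity_holds :
    seregin2024_axisym_typeII_scenario_excluded_vorticity :=
  fun _v _q _G _H _W _m _s₁ _l₁ _c hyp _ => hyp.tendsto_morreyM

end Literature.Analysis.FluidPDE

end
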